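import Literature.NumberTheory.EllipticCurves.LatticeAnalyticRepresentation
import Literature.NumberTheory.EllipticCurves.IsogenyGeomEndRingProofs
import Literature.NumberTheory.EllipticCurves.VariableChangePointsMap
import Literature.NumberTheory.EllipticCurves.ComplexMultiplicationHasCMProofs
import HarnessLib

/-!
# The analytic representation `End_{ℚ̄}(E) → ℂ` of the endomorphism ring of `E/ℚ`

Topic `NumberTheory/EllipticCurves`.  For an elliptic curve `E/ℚ` in short Weierstrass form whose
base change to `ℂ` *is* the curve `E_Λ : y² = x³ − (g₂/4)x − g₃/4` of a lattice `Λ`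
(`PeriodPair.curve`, `ComplexTorus.lean`), and an embedding `σ : ℚ̄ → ℂ`, this file constructs the
**analytic representation**

  `ρ = analyticReprHom : E.geomEndRing →+* ℂ`,   `End_{ℚ̄}(E) ∋ φ ↦ α_φ`,

characterised by `σ(φ m) = π(α_φ z)` whenever `σ(m) = π(z)` (`π : ℂ → E_Λ(ℂ)`, `z ↦ (℘ z, ℘' z/2)`,
`PeriodPair.toPoint`), and proves that it is an injective ring homomorphism with image in
`End(Λ) = {α : αΛ ⊆ Λ}`.  This is Silverman, *AEC*, Thm. VI.5.3 with Prop. VI.5.4 / display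
(`End(E) ≅ End(Λ)`, direction `End(E) → End(Λ)`), Cox, *Primes of the form x² + ny²*, §14.B
("`End_ℂ(E) = {α ∈ ℂ : αL ⊂ L}`"), transported from `ℂ` to `ℚ̄`-points along `σ`
(Silverman, *Advanced Topics*, Thm. II.2.2(c)).  Everything is **proved** (the one analytic input
is the tree's `PeriodPair.exists_forall_map_eq_toPoint_mul_of_curve_endomorphism`,
`LatticeAnalyticRepresentation.lean`); no named facts.

* `latticePointEmb hE σ : E.geomPoints →+ E_Λ(ℂ)` — `E(ℚ̄) ↪ E(ℂ)` along `σ` (Mathlib's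
  `Affine.Point.map` followed by the tree's `Affine.Point.congrEquiv hE`); injective, given by
  `σ` on coordinates, with image containing all torsion (`#E(ℚ̄)[n] = #E_Λ(ℂ)[n] = n²`) and hence
  all division points of `Λ`;
* `exists_forall_map_eq_toPoint_mul` / `mul_unique` — existence and uniqueness of `α_φ`;
* `analyticRepr`, `analyticReprHom` (a `RingHom`), `map_eq_toPoint_analyticRepr_mul` (the
  defining identity), `analyticReprHom_injective`, `analyticRepr_mul_mem_lattice` (`α_φ Λ ⊆ Λ`),
  `analyticRepr_intCast`.

The degree formula `#ker φ = N(α_φ) = [Λ : α_φΛ]` (Cox §14.B, "`deg(α) = |L/αL| = N(α)`") is the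
sibling `CMAnalyticDegreeProofs.lean`.

## References

* J. H. Silverman, *The Arithmetic of Elliptic Curves*, 2nd ed., GTM 106 (2009), Thm. VI.4.1(b),
  Thm. VI.5.3, Prop. VI.5.4. [SilvermanAEC2009]
* J. H. Silverman, *Advanced Topics in the Arithmetic of Elliptic Curves*, GTM 151 (1994),
  Prop. II.1.1, Thm. II.2.2(c). [SilvermanAdvancedTopics1994]
* D. A. Cox, *Primes of the form x² + ny²*, 2nd ed. (2013), §14.B (PDF pp. 318–319). [Cox2013]
-/

noncomputable section

open scoped Classical

namespace Literature.NumberTheory.EllipticCurves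

open WeierstrassCurve PeriodPair

universe u

/-- Rewriting the coordinates of an affine point (the nonsingularity proof is irrelevant); a
private copy of the tree's `point_some_congr` (`ReductionHomomorphism.lean`), to keep the imports
light. [folklore] -/
private theorem affinePoint_some_congr {F : Type u} [Field F] {V : WeierstrassCurve F} {x y x' y' : F}
    (h : V.toAffine.Nonsingular x y) (h' : V.toAffine.Nonsingular x' y') (hx : x = x')
    (hy : y = y') : (Affine.Point.some x y h : V.toAffine.Point) = Affine.Point.some x' y' h' := by
  subst hx hy; rfl

section Setup

variable {E : WeierstrassCurve ℚ} {L : PeriodPair} (hE : E.baseChange ℂ = L.curve)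
  (σ : AlgebraicClosure ℚ →ₐ[ℚ] ℂ)

/-! ### The embedding `E(ℚ̄) ↪ E_Λ(ℂ)` along `σ` -/

/-- **`E(ℚ̄) ↪ E_Λ(ℂ)`**: the group homomorphism on points induced by the embedding `σ : ℚ̄ → ℂ`
(Mathlib `Affine.Point.map`), read on `E_Λ` through the equality of curves `E ⊗ ℂ = E_Λ`
(`Affine.Point.congrEquiv`). Silverman, *AEC*, III.§2 (functoriality of the group law).
[folklore] -/
def latticePointEmb : E.geomPoints →+ L.curve.toAffine.Point :=
  (Affine.Point.congrEquiv hE).toAddMonoidHom.comp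
    (Affine.Point.map (W' := E) σ : E.geomPoints →+ (E.baseChange ℂ).toAffine.Point)

/-- The embedding `E(ℚ̄) ↪ E_Λ(ℂ)` is injective. [folklore] -/
theorem latticePointEmb_injective : Function.Injective (latticePointEmb hE σ) :=
  (Affine.Point.congrEquiv hE).injective.comp (Affine.Point.map_injective (W' := E) σ)

include hE in
/-- Nonsingularity transported along `σ` and `E ⊗ ℂ = E_Λ`. [folklore] -/
theorem nonsingular_curve_of_nonsingular {x y : AlgebraicClosure ℚ}
    (h : (E.baseChange (AlgebraicClosure ℚ)).toAffine.Nonsingular x y) :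
    L.curve.toAffine.Nonsingular (σ x) (σ y) := by
  rw [← hE]; exact (E.toAffine.baseChange_nonsingular σ.injective x y).mpr h

/-- The embedding acts by `σ` on coordinates. [folklore] -/
theorem latticePointEmb_some {x y : AlgebraicClosure ℚ}
    (h : (E.baseChange (AlgebraicClosure ℚ)).toAffine.Nonsingular x y) :
    latticePointEmb hE σ (Affine.Point.some x y h) =
      Affine.Point.some (σ x) (σ y) (nonsingular_curve_of_nonsingular hE σ h) := by
  simp only [latticePointEmb, AddMonoidHom.coe_comp, AddEquiv.coe_toAddMonoidHom,
    Function.comp_apply]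
  erw [Affine.Point.map_some σ h]
  rw [Affine.Point.congrEquiv_some]

variable [E.IsElliptic]

/-- **All torsion of `E_Λ(ℂ)` comes from `E(ℚ̄)`**: both `n`-torsion groups have `n²` elements
(`#E[n] = n²` over `ℚ̄` and over `ℂ`, Silverman *AEC* III.6.4(b); the tree's
`natCard_torsionBy_geomPoints`, `card_torsionBy_eq_sq`) and the embedding is injective.
[cite: SilvermanAEC2009, Cor. III.6.4(b)] -/
theorem mem_range_latticePointEmb_of_nsmul_eq_zero {n : ℕ} (hn : 0 < n)
    {P : L.curve.toAffine.Point} (hP : n • P = 0) : P ∈ (latticePointEmb hE σ).range := by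
  set f := latticePointEmb hE σ with hf
  have hfinj : Function.Injective f := latticePointEmb_injective hE σ
  have hn' : (n : ℤ) ≠ 0 := by exact_mod_cast hn.ne'
  have h1 : Nat.card (AddSubgroup.torsionBy E.geomPoints (n : ℤ)) = n ^ 2 := by
    rw [natCard_torsionBy_geomPoints (W := E) hn', Int.natAbs_natCast]
  have h2 : Nat.card (AddSubgroup.torsionBy L.curve.toAffine.Point (n : ℤ)) = n ^ 2 :=
    WeierstrassCurve.card_torsionBy_eq_sq (E := L.curve) (by exact_mod_cast hn.ne')
  set T₁ : Set E.geomPoints :=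
    (AddSubgroup.torsionBy E.geomPoints (n : ℤ) : Set E.geomPoints) with hT₁
  set T₂ : Set L.curve.toAffine.Point :=
    (AddSubgroup.torsionBy L.curve.toAffine.Point (n : ℤ) : Set L.curve.toAffine.Point) with hT₂
  have hsub : f '' T₁ ⊆ T₂ := by
    rintro _ ⟨m, hm, rfl⟩
    simp only [hT₁, hT₂, SetLike.mem_coe, AddSubgroup.torsionBy.nsmul_iff] at hm ⊢
    rw [← map_nsmul, hm, map_zero]
  have hT₂fin : T₂.Finite := by
    have : Finite (AddSubgroup.torsionBy L.curve.toAffine.Point (n : ℤ)) :=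
      Nat.finite_of_card_ne_zero (by rw [h2]; exact pow_ne_zero 2 hn.ne')
    exact Set.toFinite _
  have hcard : T₂.ncard ≤ (f '' T₁).ncard := by
    rw [Set.ncard_image_of_injective _ hfinj, ← Nat.card_coe_set_eq, ← Nat.card_coe_set_eq]
    exact (h2.trans h1.symm).le
  have heq : f '' T₁ = T₂ := Set.eq_of_subset_of_ncard_le hsub hcard hT₂fin
  have hP' : P ∈ T₂ := by
    simpa only [hT₂, SetLike.mem_coe, AddSubgroup.torsionBy.nsmul_iff] using hP
  rw [← heq] at hP'
  obtain ⟨m, -, hm⟩ := hP'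
  exact ⟨m, hm⟩

/-- The division points `l/n` of `Λ` (`l ∈ Λ`, `n ≥ 1`) parametrise points of `E_Λ(ℂ)` coming
from `E(ℚ̄)` (they are `n`-torsion). [folklore] -/
theorem exists_latticePointEmb_eq_toPoint_div {n : ℕ} (hn : 0 < n) {l : ℂ} (hl : l ∈ L.lattice) :
    ∃ m : E.geomPoints, latticePointEmb hE σ m = L.toPoint (l / n) := by
  obtain ⟨m, hm⟩ := mem_range_latticePointEmb_of_nsmul_eq_zero hE σ hn
    (P := L.toPoint (l / n)) (by
      rw [← toPointHom_apply (toPoint_add_holds (L := L)), ← map_nsmul, toPointHom_apply,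
        nsmul_eq_mul, mul_div_cancel₀ _ (by exact_mod_cast hn.ne')]
      exact toPoint_of_mem hl)
  exact ⟨m, hm⟩

omit [E.IsElliptic] in
/-- Every point of `E(ℚ̄)` is `π(z)` for some `z ∈ ℂ` (`π` is onto). [folklore] -/
theorem exists_latticePointEmb_eq_toPoint (m : E.geomPoints) :
    ∃ z : ℂ, latticePointEmb hE σ m = L.toPoint z := by
  obtain ⟨z, hz⟩ := L.toPoint_surjective (latticePointEmb hE σ m)
  exact ⟨z, hz.symm⟩

/-! ### Existence and uniqueness of the multiplier `α_φ` -/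

/-- **Existence of the analytic representation** of a geometric endomorphism `φ ∈ End_{ℚ̄}(E)`:
there is `α ∈ ℂ` with `σ(φ m) = π(αz)` whenever `σ(m) = π(z)`.  An element of `End_{ℚ̄}(E)` is
zero or an algebraic additive map (`mem_geomEndRing_iff_holds`); its rational description, with
coefficients pushed along `σ`, is that of
`PeriodPair.exists_forall_map_eq_toPoint_mul_of_curve_endomorphism` (Silverman, *AEC*,
Thm. VI.4.1(b) and Thm. VI.5.3). [cite: SilvermanAEC2009, Thm. VI.4.1(b) and Thm. VI.5.3] -/
theorem exists_forall_map_eq_toPoint_mul {φ : AddMonoid.End E.geomPoints}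
    (hφ : φ ∈ E.geomEndRing) :
    ∃ α : ℂ, ∀ (m : E.geomPoints) (z : ℂ), latticePointEmb hE σ m = L.toPoint z →
      latticePointEmb hE σ (φ m) = L.toPoint (α * z) := by
  set f := latticePointEmb hE σ with hf
  rcases (mem_geomEndRing_iff_holds (W := E) φ).1 hφ with h0 | halg
  · refine ⟨0, fun m z _ ↦ ?_⟩
    rw [h0, zero_mul, toPoint_zero]
    exact map_zero f
  obtain ⟨P₁, Q₁, P₂, Q₂, hfin⟩ := halg
  set σr : AlgebraicClosure ℚ →+* ℂ := (σ : AlgebraicClosure ℚ →+* ℂ) with hσr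
  have hσr_apply : ∀ a, σr a = σ a := fun a ↦ rfl
  have heval : ∀ (P : MvPolynomial (Fin 2) (AlgebraicClosure ℚ)) (x y : AlgebraicClosure ℚ),
      MvPolynomial.eval ![σ x, σ y] (MvPolynomial.map σr P) = σ (MvPolynomial.eval ![x, y] P) := by
    intro P x y
    have hv : (⇑σr) ∘ ![x, y] = ![σ x, σ y] := by
      funext i
      fin_cases i <;> rfl
    rw [← hσr_apply (MvPolynomial.eval ![x, y] P), MvPolynomial.map_eval σr ![x, y] P, hv]
  set p₁ := MvPolynomial.map σr P₁ with hp₁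
  set q₁ := MvPolynomial.map σr Q₁ with hq₁
  set p₂ := MvPolynomial.map σr P₂ with hp₂
  set q₂ := MvPolynomial.map σr Q₂ with hq₂
  -- the rational description survives the transport
  have halg' : {m : E.geomPoints | ¬ ∃ (x y : ℂ) (h : L.curve.toAffine.Nonsingular x y),
      f m = .some x y h ∧ MvPolynomial.eval ![x, y] q₁ ≠ 0 ∧ MvPolynomial.eval ![x, y] q₂ ≠ 0 ∧
      ∃ h' : L.curve.toAffine.Nonsingular
          (MvPolynomial.eval ![x, y] p₁ / MvPolynomial.eval ![x, y] q₁)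
          (MvPolynomial.eval ![x, y] p₂ / MvPolynomial.eval ![x, y] q₂),
        f (φ m) = .some _ _ h'}.Finite := by
    refine hfin.subset fun m hm hagree ↦ hm ?_
    obtain ⟨x, y, h, hPm, hQ₁, hQ₂, h', hφP⟩ := hagree
    have hns : L.curve.toAffine.Nonsingular (σ x) (σ y) := nonsingular_curve_of_nonsingular hE σ h
    have hns' := nonsingular_curve_of_nonsingular hE σ h'
    have hfm : f m = .some (σ x) (σ y) hns := by
      rw [hPm]; exact latticePointEmb_some hE σ h
    have hfφ : f (φ m) = .some (σ (MvPolynomial.eval ![x, y] P₁ / MvPolynomial.eval ![x, y] Q₁))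
        (σ (MvPolynomial.eval ![x, y] P₂ / MvPolynomial.eval ![x, y] Q₂)) hns' := by
      rw [hφP]; exact latticePointEmb_some hE σ h'
    have hx' : σ (MvPolynomial.eval ![x, y] P₁ / MvPolynomial.eval ![x, y] Q₁) =
        MvPolynomial.eval ![σ x, σ y] p₁ / MvPolynomial.eval ![σ x, σ y] q₁ := by
      rw [map_div₀, heval, heval]
    have hy' : σ (MvPolynomial.eval ![x, y] P₂ / MvPolynomial.eval ![x, y] Q₂) =
        MvPolynomial.eval ![σ x, σ y] p₂ / MvPolynomial.eval ![σ x, σ y] q₂ := by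
      rw [map_div₀, heval, heval]
    have hns'' : L.curve.toAffine.Nonsingular
        (MvPolynomial.eval ![σ x, σ y] p₁ / MvPolynomial.eval ![σ x, σ y] q₁)
        (MvPolynomial.eval ![σ x, σ y] p₂ / MvPolynomial.eval ![σ x, σ y] q₂) := by
      rw [← hx', ← hy']; exact hns'
    refine ⟨σ x, σ y, hns, hfm, ?_, ?_, hns'', hfφ.trans (affinePoint_some_congr hns' hns'' hx' hy')⟩
    · rw [heval]; exact (map_ne_zero σ).2 hQ₁
    · rw [heval]; exact (map_ne_zero σ).2 hQ₂
  have htors : ∀ n : ℕ, 0 < n → ∀ P : L.curve.toAffine.Point, n • P = 0 → P ∈ f.range :=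
    fun n hn P hP ↦ mem_range_latticePointEmb_of_nsmul_eq_zero hE σ hn hP
  exact L.exists_forall_map_eq_toPoint_mul_of_curve_endomorphism (M := E.geomPoints)
    (φ : E.geomPoints →+ E.geomPoints) f (latticePointEmb_injective hE σ) p₁ q₁ p₂ q₂ halg' htors

/-- **Uniqueness of the multiplier**: two complex numbers `α, β` with `π(αz) = π(βz)` for every
`z` parametrising a point of `E(ℚ̄)` coincide (the division points of `Λ` are such `z`, and
`PeriodPair.mul_unique_of_toPoint_mul_eq`). [folklore] -/
theorem mul_unique {α β : ℂ}
    (h : ∀ (m : E.geomPoints) (z : ℂ), latticePointEmb hE σ m = L.toPoint z →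
      L.toPoint (α * z) = L.toPoint (β * z)) : α = β := by
  set G : AddSubgroup ℂ := (latticePointEmb hE σ).range.comap
    (toPointHom (toPoint_add_holds (L := L))) with hG
  refine L.mul_unique_of_toPoint_mul_eq (G := G) (fun n hn l hl ↦ ?_) (fun z hz ↦ ?_)
  · obtain ⟨m, hm⟩ := exists_latticePointEmb_eq_toPoint_div hE σ hn hl
    rw [hG, AddSubgroup.mem_comap, toPointHom_apply]
    exact ⟨m, hm⟩
  · rw [hG, AddSubgroup.mem_comap, toPointHom_apply] at hz
    obtain ⟨m, hm⟩ := hz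
    exact h m z hm

/-! ### The analytic representation as a ring homomorphism -/

/-- **The analytic representation `α_φ` of `φ ∈ End_{ℚ̄}(E)`**: the complex number with
`σ(φ m) = π(α_φ z)` whenever `σ(m) = π(z)` (Silverman, *AEC*, VI.5.3; *Advanced Topics*,
Prop. II.1.1, where `[α]^*ω = αω` pins the sign).  Chosen by `Classical.choose` from
`exists_forall_map_eq_toPoint_mul`; unique by `mul_unique`. [cite: SilvermanAEC2009, Thm. VI.5.3] -/
def analyticRepr (φ : E.geomEndRing) : ℂ :=
  (exists_forall_map_eq_toPoint_mul hE σ φ.2).choose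

/-- The defining identity of `α_φ`: `σ(φ m) = π(α_φ z)` whenever `σ(m) = π(z)`. [folklore] -/
theorem map_eq_toPoint_analyticRepr_mul (φ : E.geomEndRing) {m : E.geomPoints} {z : ℂ}
    (hm : latticePointEmb hE σ m = L.toPoint z) :
    latticePointEmb hE σ ((φ : AddMonoid.End E.geomPoints) m) =
      L.toPoint (analyticRepr hE σ φ * z) :=
  (exists_forall_map_eq_toPoint_mul hE σ φ.2).choose_spec m z hm

/-- Characterisation: any `α` satisfying the defining identity of `φ` is `α_φ`. [folklore] -/
theorem analyticRepr_eq_of_forall (φ : E.geomEndRing) {α : ℂ}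
    (h : ∀ (m : E.geomPoints) (z : ℂ), latticePointEmb hE σ m = L.toPoint z →
      latticePointEmb hE σ ((φ : AddMonoid.End E.geomPoints) m) = L.toPoint (α * z)) :
    analyticRepr hE σ φ = α :=
  mul_unique hE σ fun m z hm ↦ by rw [← map_eq_toPoint_analyticRepr_mul hE σ φ hm, h m z hm]

/-- `α_1 = 1`. [folklore] -/
theorem analyticRepr_one : analyticRepr hE σ (1 : E.geomEndRing) = 1 :=
  analyticRepr_eq_of_forall hE σ 1 fun m z hm ↦ by simpa using hm

/-- `α_{φψ} = α_φ α_ψ`. [folklore] -/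
theorem analyticRepr_mul (φ ψ : E.geomEndRing) :
    analyticRepr hE σ (φ * ψ) = analyticRepr hE σ φ * analyticRepr hE σ ψ :=
  analyticRepr_eq_of_forall hE σ (φ * ψ) fun m z hm ↦ by
    have h1 := map_eq_toPoint_analyticRepr_mul hE σ ψ hm
    have h2 := map_eq_toPoint_analyticRepr_mul hE σ φ h1
    rw [Subring.coe_mul, AddMonoid.End.coe_mul, Function.comp_apply, h2, ← mul_assoc]

/-- `α_0 = 0`. [folklore] -/
theorem analyticRepr_zero : analyticRepr hE σ (0 : E.geomEndRing) = 0 :=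
  analyticRepr_eq_of_forall hE σ 0 fun m z _ ↦ by
    rw [ZeroMemClass.coe_zero, AddMonoid.End.zero_apply, map_zero, zero_mul, toPoint_zero]

/-- `α_{φ+ψ} = α_φ + α_ψ` (additivity of `π`, `PeriodPair.toPoint_add_holds`). [folklore] -/
theorem analyticRepr_add (φ ψ : E.geomEndRing) :
    analyticRepr hE σ (φ + ψ) = analyticRepr hE σ φ + analyticRepr hE σ ψ :=
  analyticRepr_eq_of_forall hE σ (φ + ψ) fun m z hm ↦ by
    have hadd : ((φ : AddMonoid.End E.geomPoints) + (ψ : AddMonoid.End E.geomPoints)) m =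
        (φ : AddMonoid.End E.geomPoints) m + (ψ : AddMonoid.End E.geomPoints) m := rfl
    rw [Subring.coe_add, hadd, map_add,
      map_eq_toPoint_analyticRepr_mul hE σ φ hm, map_eq_toPoint_analyticRepr_mul hE σ ψ hm, add_mul,
      toPoint_add_holds (L := L)]

/-- **The analytic representation `ρ : End_{ℚ̄}(E) →+* ℂ`, `φ ↦ α_φ`, is a ring homomorphism**
(Silverman, *AEC*, Thm. VI.5.3: "the natural inclusion `End(E) ≅ End(Λ)`"; Cox, *Primes of the
form x² + ny²*, §14.B). [cite: SilvermanAEC2009, Thm. VI.5.3] -/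
def analyticReprHom : E.geomEndRing →+* ℂ where
  toFun := analyticRepr hE σ
  map_one' := analyticRepr_one hE σ
  map_mul' := analyticRepr_mul hE σ
  map_zero' := analyticRepr_zero hE σ
  map_add' := analyticRepr_add hE σ

/-- `analyticReprHom` is `analyticRepr` as a function. [folklore] -/
@[simp] theorem analyticReprHom_apply (φ : E.geomEndRing) :
    analyticReprHom hE σ φ = analyticRepr hE σ φ :=
  rfl

/-- **The analytic representation is injective** (`α_φ = 0` forces `σ(φ m) = π(0) = O` for all
`m`, as every point of `E(ℚ̄)` is some `π(z)`). [cite: SilvermanAEC2009, Thm. VI.5.3] -/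
theorem analyticReprHom_injective : Function.Injective (analyticReprHom hE σ) := by
  refine (injective_iff_map_eq_zero _).2 fun φ hφ ↦ ?_
  rw [analyticReprHom_apply] at hφ
  apply Subtype.ext
  refine AddMonoidHom.ext fun m ↦ ?_
  obtain ⟨z, hz⟩ := exists_latticePointEmb_eq_toPoint hE σ m
  have h := map_eq_toPoint_analyticRepr_mul hE σ φ hz
  rw [hφ, zero_mul, toPoint_zero] at h
  change (φ : AddMonoid.End E.geomPoints) m = 0
  exact latticePointEmb_injective hE σ (by rw [h, map_zero])

/-- **`α_φ Λ ⊆ Λ`**: the analytic representation lands in `End(Λ) = {α : αΛ ⊆ Λ}` (take `m = O`,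
`z = l ∈ Λ`). Cox, *Primes of the form x² + ny²*, §14.B; Silverman, *AEC*, VI.5.3.
[cite: Cox2013, §14.B (PDF p. 318)] -/
theorem analyticRepr_mul_mem_lattice (φ : E.geomEndRing) {l : ℂ} (hl : l ∈ L.lattice) :
    analyticRepr hE σ φ * l ∈ L.lattice := by
  have h := map_eq_toPoint_analyticRepr_mul hE σ φ (m := 0) (z := l)
    (by rw [map_zero, toPoint_of_mem hl])
  rw [map_zero, map_zero] at h
  exact toPoint_eq_zero_iff.1 h.symm

/-- `α_{[n]} = n` for `n ∈ ℤ`. [folklore] -/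
theorem analyticRepr_intCast (n : ℤ) :
    analyticRepr hE σ (n : E.geomEndRing) = n := by
  rw [← analyticReprHom_apply, map_intCast]

/-- The point `m` lies in the kernel of `φ` iff `α_φ z ∈ Λ`, where `σ(m) = π(z)`. [folklore] -/
theorem apply_eq_zero_iff_analyticRepr_mul_mem (φ : E.geomEndRing) {m : E.geomPoints} {z : ℂ}
    (hm : latticePointEmb hE σ m = L.toPoint z) :
    (φ : AddMonoid.End E.geomPoints) m = 0 ↔ analyticRepr hE σ φ * z ∈ L.lattice := by
  rw [← toPoint_eq_zero_iff, ← map_eq_toPoint_analyticRepr_mul hE σ φ hm,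
    ← (latticePointEmb hE σ).map_zero]
  exact ⟨fun h ↦ by rw [h], fun h ↦ latticePointEmb_injective hE σ h⟩

end Setup

end Literature.NumberTheory.EllipticCurves

end
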